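/-
Copyright (c) 2026. All rights reserved.
Released under Apache 2.0 license as described in the file LICENSE.
Authors: abc-iut cell, seat abc-iut-L6-t6 (the last sentence of [IUTchIII] Example 3.6 (iii), part 5:
capstone — the whole class of indeterminacies dies on THE perfection and THE realification; proof-only).
-/
import Literature.IUT.LogThetaLattice.GlobalFrobenioidModelsUnitTwistClassification
import Literature.IUT.LogThetaLattice.GlobalFrobenioidModelsPerfectionRigidity
import Literature.IUT.LogThetaLattice.GlobalFrobenioidModelsRealificationRigidity
import HarnessLib

/-!
# [IUTchIII] Example 3.6 (iii), last sentence — capstone: every admissible isomorphism of Frobenioids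
# `𝓕⊛_𝔪𝔬𝔡 ⥲ 𝓕⊛_𝔪𝔬𝔡` induces THE SAME functor on the perfection and on the realification

S. Mochizuki, *Inter-universal Teichmüller Theory III*, kurims manuscript (May 2020), Example 3.6 (iii),
p. 108 [claim key Mochizuki2012, status disputed (D-0012)]: "… although the above isomorphism of Frobenioids is
not necessarily determined by the condition that it induce the identity morphism on `F^×_mod`, the induced
isomorphism between the respective perfections [hence also on realifications] of `𝓕⊛_𝔪𝔬𝔡`, `𝓕⊛_MOD` is completely
determined by this condition."

This proof-only file assembles the four kernel pieces of this seat into the statement over the CLASS of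
isomorphisms (READING disclosed in parts 1–4: functors on the nose; "admissible" = identity on objects,
Frobenius degrees preserved, identity on the rational function of every linear morphism — the printed
condition "induces the identity morphism on `F^×_mod`" — and full):
* part 1 `GlobalFrobenioidModelsUnitTwist.lean` — the unit twists `Ψ_u` (indeterminacy exhibited, `Ψ_u ≠ 𝟭`);
* part 2 `GlobalFrobenioidModelsPerfectionRigidity.lean` — `perfection_map_eq_of_isOfFinOrder` (torsion
  discrepancies die on THE perfection `C^pf` of [FrdI] Def. 3.1 (iii), abc-iut-L1-d9's `PreFrobenioid.Perfection.map`);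
* part 3 `GlobalFrobenioidModelsRealificationRigidity.lean` — `Ψ_u ⋙ realification = realification` at the
  number-field model (abc-iut-w5-d153's `Prop37.realification`, [FrdI] Prop. 5.3), and the Kronecker dictionary
  `Prop37.beta_eq_zero_iff_isOfFinOrder`;
* part 4 `GlobalFrobenioidModelsUnitTwistClassification.lean` — every admissible `Ψ` IS some `Ψ_u`.

Results:
* `FrakCat.perfection_map_unitTwist` (abstract datum) — for `u` of FINITE ORDER, `(Ψ_u)^pf = (𝟭)^pf` as functors
  `(𝓕⊛_𝔪𝔬𝔡)^pf → (𝓕⊛_𝔪𝔬𝔡)^pf` (part 2 applied to the discrepancy `u^{1−n}`);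
* `FrakCat.perfection_map_eq_of_admissible` (abstract datum) — every admissible `Ψ` whose twisting unit is
  torsion induces `(𝟭)^pf` on THE perfection;
* **`Prop37.ex36iii_determined`** (number-field model, `(†𝓕⊛_𝔪𝔬𝔡)_α = Prop37.Ffrak F`, NO torsion hypothesis —
  Kronecker): every admissible `Ψ` is `Ψ_u` for a root of unity `u`, induces `(𝟭)^pf` on THE perfection and
  satisfies `Ψ ⋙ realification = realification` — "completely determined by this condition", for the whole
  class, on the nose.
Theorems only; no new definitions.  HONEST FRAMING: elementary category theory of the tree's own model of
Ex. 3.6 plus Kronecker's theorem; nothing here bears on [IUTchIII] Cor. 3.12; typed ≠ endorsed.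
-/

namespace Literature.IUT.LogThetaLattice

open CategoryTheory Literature.AlgebraicGeometry.Frobenioids PreFrobenioid

namespace GlobalFrobenioidModels

namespace FrakCat

universe u

variable {F : Type u} [Field F] {V : Type u} {Γ : V → Type u} [∀ v, AddCommGroup (Γ v)]
  {nonneg : ∀ v, AddSubmonoid (Γ v)} {β : ∀ v, Additive Fˣ →+ Γ v}
  {H : ModelHyps nonneg β} {hF : PreFrobenioid.IsFrobenioid (structureFunctor H)}

/-- The discrepancy between `Ψ_u` and `𝟭` on a morphism `(n, f)` is `u^{1−n}`: of finite order when `u` is.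
([IUTchIII] Ex 3.6 (iii) p.108) [claim: Mochizuki2012, status: disputed] -/
theorem isOfFinOrder_fn_unitTwist_div (u : Fˣ) (hu : ∀ v, β v (Additive.ofMul u) = 0) (hfin : IsOfFinOrder u)
    {X Y : FrakCat F V Γ nonneg β} (φ : X ⟶ Y) :
    IsOfFinOrder (fn ((unitTwist u hu).map φ) / fn ((𝟭 (FrakCat F V Γ nonneg β)).map φ)) := by
  rw [fn_unitTwist_map, Functor.id_map, mul_right_comm, mul_div_cancel_right]
  exact hfin.mul (isOfFinOrder_inv_iff.mpr hfin).pow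

/-- **`(Ψ_u)^pf = (𝟭)^pf` for `u` of finite order** (abstract datum): the unit twist by a TORSION unit at
every place induces on THE perfection `(𝓕⊛_𝔪𝔬𝔡)^pf` the same functor as the identity (part 2's rigidity applied
to the discrepancy `u^{1−n}`). ([IUTchIII] Ex 3.6 (iii) p.108) [claim: Mochizuki2012, status: disputed] -/
theorem perfection_map_unitTwist (u : Fˣ) (hu : ∀ v, β v (Additive.ofMul u) = 0) (hfin : IsOfFinOrder u) :
    PreFrobenioid.Perfection.map (hF₁ := hF) (hF₂ := hF) (isFrobeniusCompatible_unitTwist u hu H) =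
      PreFrobenioid.Perfection.map (hF₁ := hF) (hF₂ := hF) (isFrobeniusCompatible_id H) :=
  perfection_map_eq_of_isOfFinOrder (isFrobeniusCompatible_id H) (isFrobeniusCompatible_unitTwist u hu H)
    (fun _ => rfl) (fun _ _ φ => deg_unitTwist_map u hu φ) (fun _ _ φ => isOfFinOrder_fn_unitTwist_div u hu hfin φ)

/-- **Every admissible `Ψ` with torsion twisting unit induces `(𝟭)^pf` on THE perfection** (abstract datum):
a full functor `Ψ : 𝓕⊛_𝔪𝔬𝔡 ⥤ 𝓕⊛_𝔪𝔬𝔡`, identity on objects, preserving Frobenius degrees, identity on the rational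
function of every linear morphism, whose value `fn Ψ(2, 1)` on part 1's `frobTwo` has finite order (automatic
at the number-field model), satisfies `Ψ^pf = (𝟭)^pf` for ANY Frobenius-compatibility witness.
([IUTchIII] Ex 3.6 (iii) p.108) [claim: Mochizuki2012, status: disputed] -/
theorem perfection_map_eq_of_admissible (Ψ : FrakCat F V Γ nonneg β ⥤ FrakCat F V Γ nonneg β)
    (hobj : ∀ X, Ψ.obj X = X) (hdeg : ∀ ⦃X Y : FrakCat F V Γ nonneg β⦄ (φ : X ⟶ Y), deg (Ψ.map φ) = deg φ)
    (hlin : ∀ ⦃X Y : FrakCat F V Γ nonneg β⦄ (φ : X ⟶ Y), deg φ = 1 → fn (Ψ.map φ) = fn φ)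
    (hfull : ∀ ⦃X Y : FrakCat F V Γ nonneg β⦄ (τ : Ψ.obj X ⟶ Ψ.obj Y), ∃ φ : X ⟶ Y, Ψ.map φ = τ)
    (hfin : IsOfFinOrder (fn (Ψ.map (frobTwo (nonneg := nonneg) (β := β)))))
    (hΨ : IsFrobeniusCompatible (structureFunctor H) (structureFunctor H) Ψ) :
    PreFrobenioid.Perfection.map (hF₁ := hF) (hF₂ := hF) hΨ = PreFrobenioid.Perfection.map (hF₁ := hF) (hF₂ := hF) (isFrobeniusCompatible_id H) := by
  obtain ⟨u, hu, huΨ⟩ := eq_unitTwist_of_full Ψ hdeg hlin H hobj hfull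
  have hfin' : IsOfFinOrder u := by
    have h : fn (Ψ.map (frobTwo (nonneg := nonneg) (β := β))) = u⁻¹ := by
      rw [huΨ]; exact fn_unitTwist_map_frobTwo u hu
    rw [h] at hfin
    exact isOfFinOrder_inv_iff.mp hfin
  subst huΨ
  exact perfection_map_unitTwist u hu hfin'

end FrakCat

end GlobalFrobenioidModels

/-! ### The number-field model: no torsion hypothesis (Kronecker) -/

namespace Prop37

open GlobalFrobenioidModels GlobalFrobenioidModels.FrakCat
open Literature.AlgebraicGeometry.Frobenioids (Places)

variable (F : Type) [Field F] [NumberField F]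

/-- **[IUTchIII] Ex. 3.6 (iii), last sentence, at the number-field model `(†𝓕⊛_𝔪𝔬𝔡)_α` — for the whole class.**
Let `Ψ : (†𝓕⊛_𝔪𝔬𝔡)_α ⥤ (†𝓕⊛_𝔪𝔬𝔡)_α` (abc-iut-w4-d005's integral datum `Prop37.Ffrak F`) be an auto-equivalence which is
the identity on objects, preserves Frobenius degrees and "induces the identity morphism on `F^×_mod`" (fixes
the rational function of every linear morphism).  Then `Ψ` is the unit twist `Ψ_u` by a ROOT OF UNITY `u` of
`F_mod` — the indeterminacy is exactly `μ(F_mod)`, nontrivial (`Ψ_{−1} ≠ 𝟭`, part 3) — and it is invisible on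
THE perfection (`Ψ^pf = (𝟭)^pf`, any compatibility witness) and on THE realification
(`Ψ ⋙ realification = realification`): "completely determined by this condition".
([IUTchIII] Ex 3.6 (iii) p.108) [claim: Mochizuki2012, status: disputed] -/
theorem ex36iii_determined (Ψ : Ffrak F ⥤ Ffrak F) [Ψ.IsEquivalence] (hobj : ∀ X, Ψ.obj X = X)
    (hdeg : ∀ ⦃X Y : Ffrak F⦄ (φ : X ⟶ Y), FrakCat.deg (Ψ.map φ) = FrakCat.deg φ)
    (hlin : ∀ ⦃X Y : Ffrak F⦄ (φ : X ⟶ Y), FrakCat.deg φ = 1 → FrakCat.fn (Ψ.map φ) = FrakCat.fn φ) :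
    (∃ (u : Fˣ) (hu : ∀ p : Places F, beta F p (Additive.ofMul u) = 0),
        IsOfFinOrder u ∧ Ψ = unitTwist u hu) ∧
      (∀ hΨ : IsFrobeniusCompatible (structureFunctor (modelHyps F)) (structureFunctor (modelHyps F)) Ψ,
        PreFrobenioid.Perfection.map (hF₁ := isFrobenioid (modelHyps F)) (hF₂ := isFrobenioid (modelHyps F)) hΨ =
          PreFrobenioid.Perfection.map (hF₁ := isFrobenioid (modelHyps F)) (hF₂ := isFrobenioid (modelHyps F))
            (isFrobeniusCompatible_id (modelHyps F))) ∧
      Ψ ⋙ realification F = realification F := by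
  obtain ⟨u, hu, huΨ⟩ :=
    eq_unitTwist_of_full Ψ hdeg hlin (modelHyps F) hobj (fun X Y τ => Ψ.map_surjective τ)
  have hfin : IsOfFinOrder u := (beta_eq_zero_iff_isOfFinOrder F u).mp hu
  refine ⟨⟨u, hu, hfin, huΨ⟩, fun hΨ => ?_, ?_⟩
  · subst huΨ
    exact perfection_map_unitTwist u hu hfin
  · subst huΨ
    exact unitTwist_comp_realification F u hu

end Prop37

end Literature.IUT.LogThetaLattice
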